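import Summits.BirchSwinnertonDyer.Rank1Residual.X11b.ChaPairsMinimality
import Summits.BirchSwinnertonDyer.Rank1Residual.X11b.KrausMinimalityGeneralTwo
import Literature.NumberTheory.EllipticCurves.ThreeIsogenyKernelX
import Literature.NumberTheory.EllipticCurves.IsogenyVariableChangeProofs
import Literature.NumberTheory.EllipticCurves.IsogenyCompProofs
import HarnessLib

/-!
# Route `KatoDescentPotSupersingular` (rung K9, cell `bsd-potss`): the `ℤ/9` CLASSES of the crux
# `WildUpperReducibleDefect` (item stmt-BirchSwinnertonDyer-19190, registered stub `stub_red_nineTorsionMember`)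
# — the ISOGENY-CLASS DATA of the three census classes IN THE KERNEL: six `3`-isogeny certificates
# (a `--supports 19190 --as helper` file; seat `bsd-potss-k9-red9` g3; nothing booked, BSD is not proved by any of
# this, item 19190 is NOT closed by this file)

WHERE THIS SITS.  The sibling file `…WildUpperReducibleNineTorsionClasses` (this seat's g2, p464900) put the
three `ℤ/9` census classes `54b`, `1890r`, `122094bl` of `Sig.stub_red_nineTorsionMember` in the kernel PER CLASS,
modulo the named published facts {bsd.S31 Creutz–Miller, Cassels, GZK, modularity} and four kinds of per-class
BINDERS: `hr` (`r_an(W₀) = 0`), `hN` (`N_{W₀} < 5000`, «no kernel conductor tool»), `hiso` (`W ∼_ℚ W₀`, «the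
Cremona class datum; no explicit-isogeny constructor in the tree») and, for `122094bl`, the `3`-descent certificate
`hSha`.  Two of those four are NOT binders — the tree has both tools.  THIS FILE discharges `hiso` for the literal
members; the companion `…WildUpperReducibleNineTorsionRecords` discharges `hN` and re-issues the records.

* §1 MODELS.  The six other Cremona minimal models of the three classes are elliptic and globally minimal
  (Kraus / Silverman VII.1.1, decided in the kernel exactly as for the three `W₀` in the sibling file).
* §2 ISOGENIES IN THE KERNEL.  `isIsogenous_of_kernelXCert`: a `3`-isogeny certificate
  `C₁ • W = [0, a, 0, b, c]`, `b² = 4ac`, `C₂ • [0, a, 0, -9b, -(27c + 8ab)] = W'` gives `W ∼_ℚ W'`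
  (Vélu's kernel-`x` isogeny `IsKernelXThreePair.toIsogeny` of the tree composed with the two isomorphisms,
  `isIsogenous_of_smul_eq`, `IsIsogenous.trans'`; the road of `X2/RouteGMemberK74958d1`).  Six certificates, found
  by exact rational arithmetic from the two rational roots `x₀` of `ψ₃` of each `W₀` (`u = 1` throughout):
  `54b1 ∼ 54b2` (`x₀ = 1`), `54b1 ∼ 54b3` (`x₀ = 0`), `1890r1 ∼ 1890r2` (`x₀ = 271`), `1890r1 ∼ 1890r3`
  (`x₀ = -72`), `122094bl1 ∼ 122094bl2` (`x₀ = 3997`), `122094bl1 ∼ 122094bl3` (`x₀ = -2862`) — the last two are the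
  two `3`-isogenies of kit j256899's descent line (the three `9`-isogenies follow by composition, companion file).
  Hence the `hiso` binder of every LITERAL member is a theorem, and so is the isogeny graph `W₉ —3— W₃ —3— W₁` of
  Cremona's table for the three classes.

ROUTE-FREE (no `Theses` import: X11b minimality tools + the isogeny prelude only), reusable by the KT twin.
HONEST FRAMING.  Kernel facts about nine explicit curves; they feed per-class records only (census-level; the extra
hypothesis «`W` lies in one of the three classes» of the sibling's stub-by-name IS the C-X3K-0 census statement for
`N < 5·10⁵`); class-wide the stub is the count fact's road (g0 file) and the item stays settled-by-citation via glue
19711 exactly as before; typed ≠ proved ≠ endorsed; nothing booked; BSD is not advanced.  THEOREMS ONLY (no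
definition, no new fact, no `sorry`).  Certificates: seat folder `census/iso3cert.py` (exact `Fraction` arithmetic,
unit-tested against `RouteGMemberK74958d1`'s certificate).

References: [CremonaAlgorithms1997] §3.8 (Vélu's formulae); [Velu1971]; [SilvermanAEC2009] III.3.1(b), III.4.12,
III.6.1, VII.1 Rem. 1.1, VIII.8; [Cremona2006] Table 1 (classes 54b, 1890r, 122094bl; isogeny matrices
[[1,3,3],[3,1,9],[3,9,1]]); [Kraus1989] Prop. 1–2.
-/

set_option autoImplicit false
-- sibling precedent (`KatoDescentPotSupersingularAssembly.lean`): the directory name repeats the summit name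
set_option linter.dupNamespace false

noncomputable section

open scoped Classical

namespace Summit.BirchSwinnertonDyer.BirchSwinnertonDyer.Theorems.WildUpperReducibleNineTorsionIsogenies

open WeierstrassCurve Literature.NumberTheory.EllipticCurves
  Literature.NumberTheory.EllipticCurves.Rank1Residual.X11RankOneCertificates
  Summit.BirchSwinnertonDyer.Rank1Residual

/-! ## §1 The six other minimal models of the three classes -/

/-- `Δ(54b2) = -39366 ≠ 0`: Cremona's model `54b2 = [1, -1, 1, -29, -53]` is an elliptic curve. [folklore] -/
theorem isElliptic_54b2 : (⟨1, -1, 1, -29, -53⟩ : WeierstrassCurve ℚ).IsElliptic :=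
  X11b.isElliptic_of_discOf_ne_zero 1 (-1) 1 (-29) (-53) (by decide +kernel)

/-- **`54b2 = [1, -1, 1, -29, -53]` is globally minimal** (`|Δ| = 2·3⁹`; Silverman's `q¹² ∤ Δ` at `2, 3`).
[cite: SilvermanAEC2009, VII.1 Remark 1.1] -/
theorem isGloballyMinimal_54b2 : (⟨1, -1, 1, -29, -53⟩ : WeierstrassCurve ℚ).IsGloballyMinimal :=
  X11b.isGloballyMinimal_of_krausCriterion_support 1 (-1) 1 (-29) (-53) [(2, 1, 1), (3, 3, 9)]
    (by intro t ht; simp only [List.mem_cons, List.not_mem_nil, or_false] at ht; rcases ht with rfl | rfl <;> norm_num)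
    (by decide +kernel) (by decide +kernel)

/-- `Δ(54b3) = -124416 ≠ 0`: Cremona's model `54b3 = [1, -1, 1, -14, 29]` (the `ℤ/9` member of `54b`) is an
elliptic curve. [folklore] -/
theorem isElliptic_54b3 : (⟨1, -1, 1, -14, 29⟩ : WeierstrassCurve ℚ).IsElliptic :=
  X11b.isElliptic_of_discOf_ne_zero 1 (-1) 1 (-14) 29 (by decide +kernel)

/-- **`54b3 = [1, -1, 1, -14, 29]` is globally minimal** (`|Δ| = 2⁹·3⁵`). [cite: SilvermanAEC2009, VII.1 Remark 1.1] -/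
theorem isGloballyMinimal_54b3 : (⟨1, -1, 1, -14, 29⟩ : WeierstrassCurve ℚ).IsGloballyMinimal :=
  X11b.isGloballyMinimal_of_krausCriterion_support 1 (-1) 1 (-14) 29 [(2, 1, 9), (3, 3, 5)]
    (by intro t ht; simp only [List.mem_cons, List.not_mem_nil, or_false] at ht; rcases ht with rfl | rfl <;> norm_num)
    (by decide +kernel) (by decide +kernel)

/-- `Δ(1890r2) = -135025380 ≠ 0`: Cremona's model `1890r2 = [1, -1, 1, -1979507, -1071477449]` is an elliptic
curve. [folklore] -/
theorem isElliptic_1890r2 : (⟨1, -1, 1, -1979507, -1071477449⟩ : WeierstrassCurve ℚ).IsElliptic :=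
  X11b.isElliptic_of_discOf_ne_zero 1 (-1) 1 (-1979507) (-1071477449) (by decide +kernel)

/-- **`1890r2 = [1, -1, 1, -1979507, -1071477449]` is globally minimal** (`|Δ| = 2²·3⁹·5·7³`).
[cite: SilvermanAEC2009, VII.1 Remark 1.1] -/
theorem isGloballyMinimal_1890r2 : (⟨1, -1, 1, -1979507, -1071477449⟩ : WeierstrassCurve ℚ).IsGloballyMinimal :=
  X11b.isGloballyMinimal_of_krausCriterion_support 1 (-1) 1 (-1979507) (-1071477449)
    [(2, 1, 2), (3, 3, 9), (5, 1, 1), (7, 1, 3)]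
    (by intro t ht; simp only [List.mem_cons, List.not_mem_nil, or_false] at ht; rcases ht with rfl | rfl | rfl | rfl <;> norm_num)
    (by decide +kernel) (by decide +kernel)

/-- `Δ(1890r3) = -42674688·10⁹ ≠ 0`: Cremona's model `1890r3 = [1, -1, 1, 63058, -7866691]` (the `ℤ/9` member of
`1890r`) is an elliptic curve. [folklore] -/
theorem isElliptic_1890r3 : (⟨1, -1, 1, 63058, -7866691⟩ : WeierstrassCurve ℚ).IsElliptic :=
  X11b.isElliptic_of_discOf_ne_zero 1 (-1) 1 63058 (-7866691) (by decide +kernel)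

/-- **`1890r3 = [1, -1, 1, 63058, -7866691]` is globally minimal** (`|Δ| = 2¹⁸·3⁵·5⁹·7³`; at `2` Silverman's
`2⁴ ∤ c₄`, `c₄` odd). [cite: SilvermanAEC2009, VII.1 Remark 1.1] -/
theorem isGloballyMinimal_1890r3 : (⟨1, -1, 1, 63058, -7866691⟩ : WeierstrassCurve ℚ).IsGloballyMinimal :=
  X11b.isGloballyMinimal_of_krausCriterion_support 1 (-1) 1 63058 (-7866691)
    [(2, 1, 18), (3, 3, 5), (5, 1, 9), (7, 1, 3)]
    (by intro t ht; simp only [List.mem_cons, List.not_mem_nil, or_false] at ht; rcases ht with rfl | rfl | rfl | rfl <;> norm_num)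
    (by decide +kernel) (by decide +kernel)

/-- `Δ(122094bl2) ≠ 0`: Cremona's model `122094bl2 = [1, -1, 1, -426456524, -3389585226281]` is an elliptic curve.
[folklore] -/
theorem isElliptic_122094bl2 :
    (⟨1, -1, 1, -426456524, -3389585226281⟩ : WeierstrassCurve ℚ).IsElliptic :=
  X11b.isElliptic_of_discOf_ne_zero 1 (-1) 1 (-426456524) (-3389585226281) (by decide +kernel)

/-- **`122094bl2 = [1, -1, 1, -426456524, -3389585226281]` is globally minimal** (`|Δ| = 2³·3⁹·7·17⁹·19³`).
[cite: SilvermanAEC2009, VII.1 Remark 1.1] -/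
theorem isGloballyMinimal_122094bl2 :
    (⟨1, -1, 1, -426456524, -3389585226281⟩ : WeierstrassCurve ℚ).IsGloballyMinimal :=
  X11b.isGloballyMinimal_of_krausCriterion_support 1 (-1) 1 (-426456524) (-3389585226281)
    [(2, 1, 3), (3, 3, 9), (7, 1, 1), (17, 1, 9), (19, 1, 3)]
    (by intro t ht; simp only [List.mem_cons, List.not_mem_nil, or_false] at ht; rcases ht with rfl | rfl | rfl | rfl | rfl <;> norm_num)
    (by decide +kernel) (by decide +kernel)

/-- `Δ(122094bl3) ≠ 0`: Cremona's model `122094bl3 = [1, -1, 1, -193010459, 1031970436427]` (the `ℤ/9` member of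
`122094bl`) is an elliptic curve. [folklore] -/
theorem isElliptic_122094bl3 :
    (⟨1, -1, 1, -193010459, 1031970436427⟩ : WeierstrassCurve ℚ).IsElliptic :=
  X11b.isElliptic_of_discOf_ne_zero 1 (-1) 1 (-193010459) 1031970436427 (by decide +kernel)

/-- **`122094bl3 = [1, -1, 1, -193010459, 1031970436427]` is globally minimal** (`|Δ| = 2²⁷·3⁵·7⁹·17·19³`; at `2`
Silverman's `2⁴ ∤ c₄`, `c₄` odd). [cite: SilvermanAEC2009, VII.1 Remark 1.1] -/
theorem isGloballyMinimal_122094bl3 :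
    (⟨1, -1, 1, -193010459, 1031970436427⟩ : WeierstrassCurve ℚ).IsGloballyMinimal :=
  X11b.isGloballyMinimal_of_krausCriterion_support 1 (-1) 1 (-193010459) 1031970436427
    [(2, 1, 27), (3, 3, 5), (7, 1, 9), (17, 1, 1), (19, 1, 3)]
    (by intro t ht; simp only [List.mem_cons, List.not_mem_nil, or_false] at ht; rcases ht with rfl | rfl | rfl | rfl | rfl <;> norm_num)
    (by decide +kernel) (by decide +kernel)

/-! ## §2 The isogeny classes in the kernel: six `3`-isogeny certificates -/

/-- **A kernel-`x` `3`-isogeny certificate gives `W ∼_ℚ W'`.** If `C₁ • W = [0, a, 0, b, c]` with `b² = 4ac` and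
`Δ ≠ 0` (so `x = 0` is a rational root of `ψ₃`, `{O, (0, ±√c)}` a `ℚ`-rational subgroup of order `3`), and
`C₂ • [0, a, 0, -9b, -(27c + 8ab)] = W'` (Vélu's quotient), then `W → C₁ • W → Vélu quotient → W'` is a `ℚ`-isogeny
of degree `3` (tree: `VariableChange.toIsogeny`, `IsKernelXThreePair.toIsogeny`, `Isogeny.comp`).
[cite: CremonaAlgorithms1997, §3.8 (Vélu's formulae)] [cite: SilvermanAEC2009, III.4.12 and III.3.1(b)] -/
theorem isIsogenous_of_kernelXCert {W W' : WeierstrassCurve ℚ} (a b c : ℚ) (C₁ C₂ : VariableChange ℚ)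
    (h₁ : C₁ • W = ⟨0, a, 0, b, c⟩) (hrel : b ^ 2 = 4 * a * c)
    (hΔ : (⟨0, a, 0, b, c⟩ : WeierstrassCurve ℚ).Δ ≠ 0) (h₂ : C₂ • kernelXThreeCodomain a b c = W') :
    IsIsogenous W W' :=
  ((isIsogenous_of_smul_eq h₁).trans' (isKernelXThreePair_mk hrel hΔ).isIsogenous).trans'
    (isIsogenous_of_smul_eq h₂)

/-- **`54b1 ∼ 54b2` over `ℚ` — IN THE KERNEL** (`ψ₃`-root `x₀ = 1` of `54b1`; `C₁ = ⟨1, 1, -1/2, -1⟩`,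
`V = [0, 9/4, 0, 3, 1]`, `C₂ = ⟨1, -1, 1/2, 1/2⟩`). [cite: Cremona2006, Table 1 (class 54b, isogeny matrix)] -/
theorem isIsogenous_54b1_54b2 :
    IsIsogenous (⟨1, -1, 1, 1, -1⟩ : WeierstrassCurve ℚ) ⟨1, -1, 1, -29, -53⟩ :=
  isIsogenous_of_kernelXCert (9 / 4) 3 1 ⟨Units.mk0 (1 : ℚ) (by norm_num), 1, -1 / 2, -1⟩
    ⟨Units.mk0 (1 : ℚ) (by norm_num), -1, 1 / 2, 1 / 2⟩
    (by ext <;> simp only [variableChange_a₁, variableChange_a₂, variableChange_a₃, variableChange_a₄,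
          variableChange_a₆, Units.val_inv_eq_inv_val, Units.val_mk0] <;> norm_num)
    (by norm_num) (by norm_num [WeierstrassCurve.Δ, WeierstrassCurve.b₂, WeierstrassCurve.b₄,
      WeierstrassCurve.b₆, WeierstrassCurve.b₈])
    (by ext <;> simp only [kernelXThreeCodomain, variableChange_a₁, variableChange_a₂, variableChange_a₃,
          variableChange_a₄, variableChange_a₆, Units.val_inv_eq_inv_val, Units.val_mk0] <;> norm_num)

/-- **`54b1 ∼ 54b3` over `ℚ` — IN THE KERNEL** (`ψ₃`-root `x₀ = 0`, the rational `3`-torsion point; `C₁ =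
⟨1, 0, -1/2, -1/2⟩`, `V = [0, -3/4, 0, 3/2, -3/4]`, `C₂ = ⟨1, 0, 1/2, 1/2⟩`; `54b3` is the `ℤ/9` member).
[cite: Cremona2006, Table 1 (class 54b, isogeny matrix)] -/
theorem isIsogenous_54b1_54b3 :
    IsIsogenous (⟨1, -1, 1, 1, -1⟩ : WeierstrassCurve ℚ) ⟨1, -1, 1, -14, 29⟩ :=
  isIsogenous_of_kernelXCert (-3 / 4) (3 / 2) (-3 / 4) ⟨Units.mk0 (1 : ℚ) (by norm_num), 0, -1 / 2, -1 / 2⟩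
    ⟨Units.mk0 (1 : ℚ) (by norm_num), 0, 1 / 2, 1 / 2⟩
    (by ext <;> simp only [variableChange_a₁, variableChange_a₂, variableChange_a₃, variableChange_a₄,
          variableChange_a₆, Units.val_inv_eq_inv_val, Units.val_mk0] <;> norm_num)
    (by norm_num) (by norm_num [WeierstrassCurve.Δ, WeierstrassCurve.b₂, WeierstrassCurve.b₄,
      WeierstrassCurve.b₆, WeierstrassCurve.b₈])
    (by ext <;> simp only [kernelXThreeCodomain, variableChange_a₁, variableChange_a₂, variableChange_a₃,
          variableChange_a₄, variableChange_a₆, Units.val_inv_eq_inv_val, Units.val_mk0] <;> norm_num)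

/-- **`1890r1 ∼ 1890r2` over `ℚ` — IN THE KERNEL** (`ψ₃`-root `x₀ = 271`; `C₁ = ⟨1, 271, -1/2, -136⟩`,
`V = [0, 3249/4, 0, 195510, 11764900]`, `C₂ = ⟨1, -271, 1/2, 1/2⟩`). [cite: Cremona2006, Table 1 (class 1890r)] -/
theorem isIsogenous_1890r1_1890r2 :
    IsIsogenous (⟨1, -1, 1, -24407, -1468369⟩ : WeierstrassCurve ℚ) ⟨1, -1, 1, -1979507, -1071477449⟩ :=
  isIsogenous_of_kernelXCert (3249 / 4) 195510 11764900 ⟨Units.mk0 (1 : ℚ) (by norm_num), 271, -1 / 2, -136⟩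
    ⟨Units.mk0 (1 : ℚ) (by norm_num), -271, 1 / 2, 1 / 2⟩
    (by ext <;> simp only [variableChange_a₁, variableChange_a₂, variableChange_a₃, variableChange_a₄,
          variableChange_a₆, Units.val_inv_eq_inv_val, Units.val_mk0] <;> norm_num)
    (by norm_num) (by norm_num [WeierstrassCurve.Δ, WeierstrassCurve.b₂, WeierstrassCurve.b₄,
      WeierstrassCurve.b₆, WeierstrassCurve.b₈])
    (by ext <;> simp only [kernelXThreeCodomain, variableChange_a₁, variableChange_a₂, variableChange_a₃,
          variableChange_a₄, variableChange_a₆, Units.val_inv_eq_inv_val, Units.val_mk0] <;> norm_num)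

/-- **`1890r1 ∼ 1890r3` over `ℚ` — IN THE KERNEL** (`ψ₃`-root `x₀ = -72`, the rational `3`-torsion point;
`C₁ = ⟨1, -72, -1/2, 71/2⟩`, `V = [0, -867/4, 0, -17493/2, -352947/4]`, `C₂ = ⟨1, 72, 1/2, 1/2⟩`; `1890r3` is the
`ℤ/9` member). [cite: Cremona2006, Table 1 (class 1890r)] -/
theorem isIsogenous_1890r1_1890r3 :
    IsIsogenous (⟨1, -1, 1, -24407, -1468369⟩ : WeierstrassCurve ℚ) ⟨1, -1, 1, 63058, -7866691⟩ :=
  isIsogenous_of_kernelXCert (-867 / 4) (-17493 / 2) (-352947 / 4)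
    ⟨Units.mk0 (1 : ℚ) (by norm_num), -72, -1 / 2, 71 / 2⟩ ⟨Units.mk0 (1 : ℚ) (by norm_num), 72, 1 / 2, 1 / 2⟩
    (by ext <;> simp only [variableChange_a₁, variableChange_a₂, variableChange_a₃, variableChange_a₄,
          variableChange_a₆, Units.val_inv_eq_inv_val, Units.val_mk0] <;> norm_num)
    (by norm_num) (by norm_num [WeierstrassCurve.Δ, WeierstrassCurve.b₂, WeierstrassCurve.b₄,
      WeierstrassCurve.b₆, WeierstrassCurve.b₈])
    (by ext <;> simp only [kernelXThreeCodomain, variableChange_a₁, variableChange_a₂, variableChange_a₃,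
          variableChange_a₄, variableChange_a₆, Units.val_inv_eq_inv_val, Units.val_mk0] <;> norm_num)

/-- **`122094bl1 ∼ 122094bl2` over `ℚ` — IN THE KERNEL** (`ψ₃`-root `x₀ = 3997`, the second `3`-isogeny of kit
j256899's row `122094bl1`; `C₁ = ⟨1, 3997, -1/2, -1999⟩`, `V = [0, 47961/4, 0, 42059388, 36883970704]`,
`C₂ = ⟨1, -3997, 1/2, 1/2⟩`). [cite: Cremona2006, Table 1 (class 122094bl)] -/
theorem isIsogenous_122094bl1_122094bl2 :
    IsIsogenous (⟨1, -1, 1, -5862644, -3527169193⟩ : WeierstrassCurve ℚ) ⟨1, -1, 1, -426456524, -3389585226281⟩ :=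
  isIsogenous_of_kernelXCert (47961 / 4) 42059388 36883970704
    ⟨Units.mk0 (1 : ℚ) (by norm_num), 3997, -1 / 2, -1999⟩ ⟨Units.mk0 (1 : ℚ) (by norm_num), -3997, 1 / 2, 1 / 2⟩
    (by ext <;> simp only [variableChange_a₁, variableChange_a₂, variableChange_a₃, variableChange_a₄,
          variableChange_a₆, Units.val_inv_eq_inv_val, Units.val_mk0] <;> norm_num)
    (by norm_num) (by norm_num [WeierstrassCurve.Δ, WeierstrassCurve.b₂, WeierstrassCurve.b₄,
      WeierstrassCurve.b₆, WeierstrassCurve.b₈])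
    (by ext <;> simp only [kernelXThreeCodomain, variableChange_a₁, variableChange_a₂, variableChange_a₃,
          variableChange_a₄, variableChange_a₆, Units.val_inv_eq_inv_val, Units.val_mk0] <;> norm_num)

/-- **`122094bl1 ∼ 122094bl3` over `ℚ` — IN THE KERNEL** (`ψ₃`-root `x₀ = -2862`, the rational `3`-torsion point
— the isogeny `x₀ = -2862`, `d = -3` of kit j256899's EXCESS-`0` line; `C₁ = ⟨1, -2862, -1/2, 2861/2⟩`,
`V = [0, -34347/4, 0, 37429563/2, -40788778827/4]`, `C₂ = ⟨1, 2862, 1/2, 1/2⟩`; `122094bl3` is the `ℤ/9` member).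
[cite: Cremona2006, Table 1 (class 122094bl)] -/
theorem isIsogenous_122094bl1_122094bl3 :
    IsIsogenous (⟨1, -1, 1, -5862644, -3527169193⟩ : WeierstrassCurve ℚ) ⟨1, -1, 1, -193010459, 1031970436427⟩ :=
  isIsogenous_of_kernelXCert (-34347 / 4) (37429563 / 2) (-40788778827 / 4)
    ⟨Units.mk0 (1 : ℚ) (by norm_num), -2862, -1 / 2, 2861 / 2⟩ ⟨Units.mk0 (1 : ℚ) (by norm_num), 2862, 1 / 2, 1 / 2⟩
    (by ext <;> simp only [variableChange_a₁, variableChange_a₂, variableChange_a₃, variableChange_a₄,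
          variableChange_a₆, Units.val_inv_eq_inv_val, Units.val_mk0] <;> norm_num)
    (by norm_num) (by norm_num [WeierstrassCurve.Δ, WeierstrassCurve.b₂, WeierstrassCurve.b₄,
      WeierstrassCurve.b₆, WeierstrassCurve.b₈])
    (by ext <;> simp only [kernelXThreeCodomain, variableChange_a₁, variableChange_a₂, variableChange_a₃,
          variableChange_a₄, variableChange_a₆, Units.val_inv_eq_inv_val, Units.val_mk0] <;> norm_num)

end Summit.BirchSwinnertonDyer.BirchSwinnertonDyer.Theorems.WildUpperReducibleNineTorsionIsogenies

end
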